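import Summits.AtomisticToContinuum.FouriersLaw.Theorems.CageBudgetFeketeUnboundedHeatVarianceNoFrozenSiteEnergyOfErgodic
import HarnessLib

/-!
# `CageBudgetFekete.UnboundedHeatVariance`, line Sketch — Cesàro relaxation of the site energy ⟹ no frozen site energy

Support file (`--supports stmt-AtomisticToContinuum-15771`) for the stub
`stub_noFrozenSiteEnergy_of_cesaroRelaxation` (edge "SR") of line `Sketch`.

In the arena of the crux let `h_x` be the split-bond site energy (`OscillatorChain.energyDensityZ`),
`m = ∫ h₀ dμ`, `S(0,t) = ∫ (h₀ - m)(h₀ ∘ φ_t - m) dμ` the on-site centred energy kernel and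
`S̄_ν(0) = Sb ν 0 = ν ∫₀^∞ e^{-νt} S(0,t) dt` its Abel mean. The weakest natural hypothesis feeding the landed
edge E (`stub_infraredNonFreezingOfNoFrozenSiteEnergy`: no frozen site energy ⟹ infrared non-freezing) is
MEAN-ERGODICITY of the site energy in Cesàro form, `T⁻¹ ∫_{(0,T]} S(0,t) dt → 0`. This file proves

* `stub_noFrozenSiteEnergy_of_cesaroRelaxation` — Cesàro ⟹ Abel: `T⁻¹ ∫_{(0,T]} S(0,·) → 0` gives
  `Sb ν 0 → 0` as `ν ↓ 0`. This is the tree's Widder Abelian theorem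
  (`Literature.Analysis.Asymptotics.Widder1941_abelian_laplace_one` with `Widder1941_abelian_laplace_holds`,
  `a := S 0`, `A := 0`); its two integrability inputs are the local integrability of `S(0,·)` (continuity,
  `continuous_onSiteEnergyKernel`, from `InfiniteChainDynamics.continuous_integral_energyDensityZ_mul_flow_pinnedChain`)
  and the absolute convergence of the Laplace integrals (clause (3) of the landed fibre calculus
  `FibreCalculusSketch.fibreCalculus_proof`);
* rider `noFrozenSiteEnergy_of_siteEnergyRelaxation` — POINTWISE relaxation `S(0,t) → 0` (mixing of the site
  energy) suffices (`tendsto_setIntegral_div_of_tendsto_zero`: pointwise decay ⟹ Cesàro decay);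
* riders `infraredNonFreezing_of_cesaroRelaxation`, `infraredNonFreezing_of_siteEnergyRelaxation` — composed
  with the landed edge E: Cesàro (resp. pointwise) relaxation of the site energy ⟹ infrared non-freezing.
-/

noncomputable section

namespace Summit.AtomisticToContinuum.FouriersLaw.Theorems.UnboundedHeatVariance.Sketch

open MeasureTheory Set Filter Topology Function
open Literature.MathematicalPhysics.KineticTheory.HeatConduction

/-! ### Pointwise decay ⟹ Cesàro decay -/

/-- **Pointwise decay implies Cesàro decay.** If `s : ℝ → ℝ` is integrable on every `(0, T]` and
`s(t) → 0` as `t → ∞`, then its Cesàro mean `t⁻¹ ∫_{(0,t]} s` tends to `0`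
(split `∫₀ᵗ = ∫₀ᴺ + ∫_N^t` with `|s| ≤ ε/2` past `N`). [folklore] -/
theorem tendsto_setIntegral_div_of_tendsto_zero {s : ℝ → ℝ} (hloc : ∀ T : ℝ, IntegrableOn s (Ioc 0 T))
    (hlim : Tendsto s atTop (𝓝 0)) :
    Tendsto (fun t : ℝ => (∫ u in Ioc 0 t, s u) / t) atTop (𝓝 0) := by
  have hii : ∀ a b : ℝ, 0 ≤ a → a ≤ b → IntervalIntegrable s volume a b := by
    intro a b ha hab
    rw [intervalIntegrable_iff_integrableOn_Ioc_of_le hab]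
    exact (hloc b).mono_set (Ioc_subset_Ioc_left ha)
  rw [Metric.tendsto_atTop] at hlim ⊢
  intro ε hε
  obtain ⟨N₀, hN₀⟩ := hlim (ε / 2) (half_pos hε)
  set N : ℝ := max N₀ 0 with hNdef
  have hN0 : 0 ≤ N := le_max_right _ _
  have hNε : ∀ u, N ≤ u → |s u| < ε / 2 := fun u hu => by
    have h := hN₀ u ((le_max_left _ _).trans hu)
    rwa [Real.dist_eq, sub_zero] at h
  set I : ℝ := ∫ u in (0:ℝ)..N, s u with hIdef
  refine ⟨max (N + 1) (2 * |I| / ε + 1), fun t ht => ?_⟩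
  have htN : N + 1 ≤ t := (le_max_left _ _).trans ht
  have htK : 2 * |I| / ε + 1 ≤ t := (le_max_right _ _).trans ht
  have ht0 : 0 < t := by linarith
  have hNt : N ≤ t := by linarith
  have hsplit : ∫ u in Ioc 0 t, s u = I + ∫ u in N..t, s u := by
    rw [← intervalIntegral.integral_of_le ht0.le,
      intervalIntegral.integral_add_adjacent_intervals (hii 0 N le_rfl hN0) (hii N t hN0 hNt)]
  have htail : |∫ u in N..t, s u| ≤ ε / 2 * |t - N| := by
    have h := intervalIntegral.norm_integral_le_of_norm_le_const (a := N) (b := t) (C := ε / 2) (f := s)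
      (fun u hu => by
        rw [uIoc_of_le hNt] at hu
        rw [Real.norm_eq_abs]
        exact (hNε u hu.1.le).le)
    rwa [Real.norm_eq_abs] at h
  have hIt : |I| < ε / 2 * t := by
    have h1 : 2 * |I| / ε < t := by linarith
    have h2 := (div_lt_iff₀ hε).mp h1
    linarith
  have hεN : 0 ≤ ε / 2 * N := mul_nonneg (half_pos hε).le hN0
  rw [Real.dist_eq, sub_zero, abs_div, abs_of_pos ht0, div_lt_iff₀ ht0, hsplit]
  calc |I + ∫ u in N..t, s u| ≤ |I| + |∫ u in N..t, s u| := abs_add_le _ _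
    _ ≤ |I| + ε / 2 * |t - N| := by linarith [htail]
    _ = |I| + ε / 2 * (t - N) := by rw [abs_of_nonneg (sub_nonneg.mpr hNt)]
    _ < ε / 2 * t + ε / 2 * t := by linarith
    _ = ε * t := by ring

/-! ### Continuity of the on-site kernel -/

/-- **Continuity of the on-site centred energy kernel.** In the arena of the crux the kernel
`t ↦ S(0,t) = ∫ (h₀ - m)(h₀ ∘ φ_t - m) dμ` (`h₀` the split-bond site energy at the origin, `m = ∫ h₀ dμ`) is
continuous: it is `∫ h₀ (h₀ ∘ φ_t) dμ - m²` (measure preservation), and the two-point function is continuous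
(`InfiniteChainDynamics.continuous_integral_energyDensityZ_mul_flow_pinnedChain`). [folklore] -/
theorem continuous_onSiteEnergyKernel {ω₂ lam β : ℝ} (γ : ℝ) (hω : 0 < ω₂) (hl : 0 < lam) (hβ : 0 < β)
    {T : ℝ} (hT : 0 < T) {μ : Measure ChainConfig} (hG : (pinnedChain ω₂ lam β γ).IsChainGibbsMeasure T μ)
    (hSI : IsShiftInvariant μ) (D : InfiniteChainDynamics (pinnedChain ω₂ lam β γ))
    (hP : D.PreservesMeasure μ) :
    Continuous fun t : ℝ => ∫ σ, ((pinnedChain ω₂ lam β γ).energyDensityZ σ 0 -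
        ∫ σ', (pinnedChain ω₂ lam β γ).energyDensityZ σ' 0 ∂μ) *
      ((pinnedChain ω₂ lam β γ).energyDensityZ (D.flow t σ) 0 -
        ∫ σ', (pinnedChain ω₂ lam β γ).energyDensityZ σ' 0 ∂μ) ∂μ := by
  have hss : (pinnedChain ω₂ lam β γ).HasSuperstabilityEstimate μ :=
    OscillatorChain.hasSuperstabilityEstimate_of_isShiftInvariant_pinnedChain γ hω hl.le hβ.le hT hG hSI
  haveI : IsProbabilityMeasure μ := hss.1
  have hUm : Measurable (pinnedChain ω₂ lam β γ).U := OscillatorChain.measurable_pinnedChain_U ω₂ lam β γ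
  have hVm : Measurable (pinnedChain ω₂ lam β γ).V := OscillatorChain.measurable_pinnedChain_V ω₂ lam β γ
  set h0 : ChainConfig → ℝ := fun σ => (pinnedChain ω₂ lam β γ).energyDensityZ σ 0 with h0def
  have h0m : Measurable h0 := (pinnedChain ω₂ lam β γ).measurable_energyDensityZ hUm hVm 0
  have h02 : MemLp h0 2 μ :=
    OscillatorChain.memLp_energyDensityZ_pinnedChain γ hω.le hl.le hβ.le hss 0 ENNReal.ofNat_ne_top
  set m : ℝ := ∫ σ, h0 σ ∂μ with hmdef
  have hmean : ∀ t : ℝ, ∫ σ, (h0 ∘ D.flow t) σ ∂μ = m := fun t =>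
    integral_comp_eq_of_measurePreserving (hP.2 t) h0m
  have hs_eq : ∀ t : ℝ, ∫ σ, (h0 σ - m) * (h0 (D.flow t σ) - m) ∂μ =
      (∫ σ, h0 σ * h0 (D.flow t σ) ∂μ) - m * m := by
    intro t
    have hY2 : MemLp (h0 ∘ D.flow t) 2 μ := h02.comp_measurePreserving (hP.2 t)
    have hcov := ProbabilityTheory.covariance_eq_sub h02 hY2
    rw [ProbabilityTheory.covariance, hmean t] at hcov
    exact hcov
  have hc := InfiniteChainDynamics.continuous_integral_energyDensityZ_mul_flow_pinnedChain γ hω.le hl.le hβ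
    hss D hP 0 0
  have e : (fun t : ℝ => ∫ σ, (h0 σ - m) * (h0 (D.flow t σ) - m) ∂μ) =
      fun t => (∫ σ, h0 σ * h0 (D.flow t σ) ∂μ) - m * m := funext hs_eq
  show Continuous fun t : ℝ => ∫ σ, (h0 σ - m) * (h0 (D.flow t σ) - m) ∂μ
  rw [e]
  exact hc.sub continuous_const

/-! ### The stub -/

/-- **Stub `stub_noFrozenSiteEnergy_of_cesaroRelaxation`** (edge "SR" of line `Sketch` of
`CageBudgetFekete.UnboundedHeatVariance`): in the arena of the crux, if the site energy is MEAN-ERGODIC in Cesàro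
form, `T⁻¹ ∫_{(0,T]} S(0,t) dt → 0` for the centred on-site energy kernel `S(0,t) = ∫ (h₀ - m)(h₀ ∘ φ_t - m) dμ`,
then it has NO FROZEN COMPONENT in Abel form: `Sb ν 0 = ν ∫₀^∞ e^{-νt} S(0,t) dt → 0` as `ν ↓ 0` — Widder's
Abelian theorem (Cesàro ⟹ Abel, `Literature.Analysis.Asymptotics.Widder1941_abelian_laplace_one`), fed by the
continuity of `S(0,·)` and the absolute convergence of its Laplace integrals (fibre calculus, clause (3)).
[folklore] -/
theorem stub_noFrozenSiteEnergy_of_cesaroRelaxation :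
    ∀ ω₂ lam β γ : ℝ, 0 < ω₂ → 0 < lam → 0 < β → ∀ T : ℝ, 0 < T → ∀ μ : MeasureTheory.Measure Literature.MathematicalPhysics.KineticTheory.HeatConduction.ChainConfig, (Literature.MathematicalPhysics.KineticTheory.HeatConduction.pinnedChain ω₂ lam β γ).IsChainGibbsMeasure T μ → Literature.MathematicalPhysics.KineticTheory.HeatConduction.IsShiftInvariant μ → μ.map (fun σ : Literature.MathematicalPhysics.KineticTheory.HeatConduction.ChainConfig => fun x : ℤ => ((σ x).1, -(σ x).2)) = μ → ∀ D : Literature.MathematicalPhysics.KineticTheory.HeatConduction.InfiniteChainDynamics (Literature.MathematicalPhysics.KineticTheory.HeatConduction.pinnedChain ω₂ lam β γ), D.PreservesMeasure μ → (∀ t : ℝ, ∀ᵐ σ ∂μ, D.flow t (Literature.MathematicalPhysics.KineticTheory.HeatConduction.shift σ) = Literature.MathematicalPhysics.KineticTheory.HeatConduction.shift (D.flow t σ)) → (∀ t : ℝ, D.HasAbsConvergentCorrelation μ t) → Continuous (fun t : ℝ => D.currentCorrelation μ t) → ∀ h : Literature.MathematicalPhysics.KineticTheory.HeatConduction.ChainConfig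 → ℤ → ℝ, h = (fun (σ : Literature.MathematicalPhysics.KineticTheory.HeatConduction.ChainConfig) (x : ℤ) => (σ x).2 ^ 2 / 2 + (Literature.MathematicalPhysics.KineticTheory.HeatConduction.pinnedChain ω₂ lam β γ).U (σ x).1 + ((Literature.MathematicalPhysics.KineticTheory.HeatConduction.pinnedChain ω₂ lam β γ).V ((σ (x + 1)).1 - (σ x).1) + (Literature.MathematicalPhysics.KineticTheory.HeatConduction.pinnedChain ω₂ lam β γ).V ((σ x).1 - (σ (x - 1)).1)) / 2) → ∀ S : ℤ → ℝ → ℝ, S = (fun (x : ℤ) (t : ℝ) => ∫ σ, (h σ 0 - ∫ σ', h σ' 0 ∂μ) * (h (D.flow t σ) x - ∫ σ', h σ' 0 ∂μ) ∂μ) → ∀ Sb : ℝ → ℤ → ℝ, Sb = (fun (ν : ℝ) (x : ℤ) => ν * ∫ t in Set.Ioi (0:ℝ), Real.exp (-(ν * t)) * S x t) → Filter.Tendsto (fun T : ℝ => (∫ t in Set.Ioc (0:ℝ) T, S 0 t) / T) Filter.atTop (nhds 0) → Filter.Tendsto (fun ν : ℝ => Sb ν 0) (nhdsWithin (0:ℝ)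 (Set.Ioi 0)) (nhds 0) := by
  intro ω₂ lam β γ hω hl hβ T hT μ hG hSI hRefl D hP hShift _hAbs _hCont h hh S hS Sb hSb hC
  /- §1 the on-site kernel `S 0` is continuous, hence locally integrable -/
  have hS0 : S 0 = fun t : ℝ => ∫ σ, ((pinnedChain ω₂ lam β γ).energyDensityZ σ 0 -
        ∫ σ', (pinnedChain ω₂ lam β γ).energyDensityZ σ' 0 ∂μ) *
      ((pinnedChain ω₂ lam β γ).energyDensityZ (D.flow t σ) 0 -
        ∫ σ', (pinnedChain ω₂ lam β γ).energyDensityZ σ' 0 ∂μ) ∂μ := by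
    subst hh hS
    rfl
  have hsc : Continuous (S 0) := by
    rw [hS0]
    exact continuous_onSiteEnergyKernel γ hω hl hβ hT hG hSI D hP
  have hloc : ∀ T' : ℝ, IntegrableOn (S 0) (Ioc 0 T') := fun T' => hsc.integrableOn_Ioc
  /- §2 absolutely convergent Laplace integrals: clause (3) of the fibre calculus -/
  have hlap : ∀ ν : ℝ, 0 < ν → IntegrableOn (fun t : ℝ => Real.exp (-(ν * t)) * S 0 t) (Ioi 0) := by
    obtain ⟨-, -, h3, -, -, -, -, -, -, -, -, -⟩ :=
      Summit.AtomisticToContinuum.FouriersLaw.Theorems.FibreCalculusSketch.fibreCalculus_proof ω₂ lam β γ hω hl hβ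
        T hT μ hG hSI hRefl D hP hShift h hh S hS Sb hSb _ rfl _ rfl _ rfl _ rfl
    exact fun ν hν => h3 0 ν hν
  /- §3 Cesàro ⟹ Abel (Widder) -/
  have key := Literature.Analysis.Asymptotics.Widder1941_abelian_laplace_one
    Literature.Analysis.Asymptotics.Widder1941_abelian_laplace_holds (S 0) 0 hloc hlap hC
  subst hSb
  exact key

/-! ### Riders -/

/-- **Rider: pointwise relaxation (mixing) of the site energy ⟹ no frozen site energy.** In the arena of the
crux, if the centred on-site energy kernel relaxes pointwise, `S(0,t) = Cov(h₀, h₀ ∘ φ_t) → 0` as `t → ∞`, then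
`Sb ν 0 → 0` as `ν ↓ 0` (pointwise ⟹ Cesàro, `tendsto_setIntegral_div_of_tendsto_zero`, then
`stub_noFrozenSiteEnergy_of_cesaroRelaxation`). [folklore] -/
theorem noFrozenSiteEnergy_of_siteEnergyRelaxation :
    ∀ ω₂ lam β γ : ℝ, 0 < ω₂ → 0 < lam → 0 < β → ∀ T : ℝ, 0 < T → ∀ μ : MeasureTheory.Measure Literature.MathematicalPhysics.KineticTheory.HeatConduction.ChainConfig, (Literature.MathematicalPhysics.KineticTheory.HeatConduction.pinnedChain ω₂ lam β γ).IsChainGibbsMeasure T μ → Literature.MathematicalPhysics.KineticTheory.HeatConduction.IsShiftInvariant μ → μ.map (fun σ : Literature.MathematicalPhysics.KineticTheory.HeatConduction.ChainConfig => fun x : ℤ => ((σ x).1, -(σ x).2)) = μ → ∀ D : Literature.MathematicalPhysics.KineticTheory.HeatConduction.InfiniteChainDynamics (Literature.MathematicalPhysics.KineticTheory.HeatConduction.pinnedChain ω₂ lam β γ), D.PreservesMeasure μ → (∀ t : ℝ, ∀ᵐ σ ∂μ, D.flow t (Literature.MathematicalPhysics.KineticTheory.HeatConduction.shift σ) = Literature.MathematicalPhysics.KineticTheory.HeatConduction.shift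 (D.flow t σ)) → (∀ t : ℝ, D.HasAbsConvergentCorrelation μ t) → Continuous (fun t : ℝ => D.currentCorrelation μ t) → ∀ h : Literature.MathematicalPhysics.KineticTheory.HeatConduction.ChainConfig → ℤ → ℝ, h = (fun (σ : Literature.MathematicalPhysics.KineticTheory.HeatConduction.ChainConfig) (x : ℤ) => (σ x).2 ^ 2 / 2 + (Literature.MathematicalPhysics.KineticTheory.HeatConduction.pinnedChain ω₂ lam β γ).U (σ x).1 + ((Literature.MathematicalPhysics.KineticTheory.HeatConduction.pinnedChain ω₂ lam β γ).V ((σ (x + 1)).1 - (σ x).1) + (Literature.MathematicalPhysics.KineticTheory.HeatConduction.pinnedChain ω₂ lam β γ).V ((σ x).1 - (σ (x - 1)).1)) / 2) → ∀ S : ℤ → ℝ → ℝ, S = (fun (x : ℤ) (t : ℝ) => ∫ σ, (h σ 0 - ∫ σ', h σ' 0 ∂μ) * (h (D.flow t σ) x - ∫ σ', h σ' 0 ∂μ) ∂μ) → ∀ Sb : ℝ → ℤ → ℝ, Sb = (fun (ν : ℝ) (x : ℤ) => ν * ∫ t in Set.Ioi (0:ℝ), Real.exp (-(ν * t)) * S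 x t) → Filter.Tendsto (fun t : ℝ => S 0 t) Filter.atTop (nhds 0) → Filter.Tendsto (fun ν : ℝ => Sb ν 0) (nhdsWithin (0:ℝ) (Set.Ioi 0)) (nhds 0) := by
  intro ω₂ lam β γ hω hl hβ T hT μ hG hSI hRefl D hP hShift hAbs hCont h hh S hS Sb hSb hrelax
  refine stub_noFrozenSiteEnergy_of_cesaroRelaxation ω₂ lam β γ hω hl hβ T hT μ hG hSI hRefl D hP hShift hAbs
    hCont h hh S hS Sb hSb (tendsto_setIntegral_div_of_tendsto_zero (fun T' => ?_) hrelax)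
  have hS0 : S 0 = fun t : ℝ => ∫ σ, ((pinnedChain ω₂ lam β γ).energyDensityZ σ 0 -
        ∫ σ', (pinnedChain ω₂ lam β γ).energyDensityZ σ' 0 ∂μ) *
      ((pinnedChain ω₂ lam β γ).energyDensityZ (D.flow t σ) 0 -
        ∫ σ', (pinnedChain ω₂ lam β γ).energyDensityZ σ' 0 ∂μ) ∂μ := by
    subst hh hS
    rfl
  rw [hS0]
  exact (continuous_onSiteEnergyKernel γ hω hl hβ hT hG hSI D hP).integrableOn_Ioc

/-- **Rider (SR ∘ E): Cesàro relaxation of the site energy ⟹ infrared non-freezing.** In the arena of the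
crux, with the energy kernel `S`, its Abel profile `Sb`, the Abel structure factor `fh ν k = Σ_x cos(kx) Sb ν x`
and the static one `χk k = Σ_x cos(kx) S x 0`: if `T⁻¹ ∫_{(0,T]} S(0,t) dt → 0`, then for every `M` and every
`ν₁ > 0` some wavenumber `k` with `cos k ≠ 1` and some `0 < ν < ν₁` have Abel deficit
`χk k - fh ν k ≥ M (2 - 2 cos k)` (`stub_noFrozenSiteEnergy_of_cesaroRelaxation` fed into the landed
`stub_infraredNonFreezingOfNoFrozenSiteEnergy`). [folklore] -/
theorem infraredNonFreezing_of_cesaroRelaxation :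
    ∀ ω₂ lam β γ : ℝ, 0 < ω₂ → 0 < lam → 0 < β → ∀ T : ℝ, 0 < T → ∀ μ : MeasureTheory.Measure Literature.MathematicalPhysics.KineticTheory.HeatConduction.ChainConfig, (Literature.MathematicalPhysics.KineticTheory.HeatConduction.pinnedChain ω₂ lam β γ).IsChainGibbsMeasure T μ → Literature.MathematicalPhysics.KineticTheory.HeatConduction.IsShiftInvariant μ → μ.map (fun σ : Literature.MathematicalPhysics.KineticTheory.HeatConduction.ChainConfig => fun x : ℤ => ((σ x).1, -(σ x).2)) = μ → ∀ D : Literature.MathematicalPhysics.KineticTheory.HeatConduction.InfiniteChainDynamics (Literature.MathematicalPhysics.KineticTheory.HeatConduction.pinnedChain ω₂ lam β γ), D.PreservesMeasure μ → (∀ t : ℝ, ∀ᵐ σ ∂μ, D.flow t (Literature.MathematicalPhysics.KineticTheory.HeatConduction.shift σ) = Literature.MathematicalPhysics.KineticTheory.HeatConduction.shift (D.flow t σ)) → (∀ t : ℝ, D.HasAbsConvergentCorrelation μ t) → Continuous (fun t : ℝ => D.currentCorrelation μ t) → ∀ h : Literature.MathematicalPhysics.KineticTheory.HeatConduction.ChainConfig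 → ℤ → ℝ, h = (fun (σ : Literature.MathematicalPhysics.KineticTheory.HeatConduction.ChainConfig) (x : ℤ) => (σ x).2 ^ 2 / 2 + (Literature.MathematicalPhysics.KineticTheory.HeatConduction.pinnedChain ω₂ lam β γ).U (σ x).1 + ((Literature.MathematicalPhysics.KineticTheory.HeatConduction.pinnedChain ω₂ lam β γ).V ((σ (x + 1)).1 - (σ x).1) + (Literature.MathematicalPhysics.KineticTheory.HeatConduction.pinnedChain ω₂ lam β γ).V ((σ x).1 - (σ (x - 1)).1)) / 2) → ∀ S : ℤ → ℝ → ℝ, S = (fun (x : ℤ) (t : ℝ) => ∫ σ, (h σ 0 - ∫ σ', h σ' 0 ∂μ) * (h (D.flow t σ) x - ∫ σ', h σ' 0 ∂μ) ∂μ) → ∀ Sb : ℝ → ℤ → ℝ, Sb = (fun (ν : ℝ) (x : ℤ) => ν * ∫ t in Set.Ioi (0:ℝ), Real.exp (-(ν * t)) * S x t) → ∀ fh : ℝ → ℝ → ℝ, fh = (fun (ν k : ℝ) => ∑' x : ℤ, Real.cos (k * (x : ℝ)) * Sb ν x) → ∀ χk : ℝ → ℝ, χk = (fun k : ℝ =>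 ∑' x : ℤ, Real.cos (k * (x : ℝ)) * S x 0) → Filter.Tendsto (fun T : ℝ => (∫ t in Set.Ioc (0:ℝ) T, S 0 t) / T) Filter.atTop (nhds 0) → ∀ M ν₁ : ℝ, 0 < ν₁ → ∃ k : ℝ, Real.cos k ≠ 1 ∧ ∃ ν : ℝ, 0 < ν ∧ ν < ν₁ ∧ M * (2 - 2 * Real.cos k) ≤ χk k - fh ν k := by
  intro ω₂ lam β γ hω hl hβ T hT μ hG hSI hRefl D hP hShift hAbs hCont h hh S hS Sb hSb fh hfh χk hχk hC
  exact stub_infraredNonFreezingOfNoFrozenSiteEnergy ω₂ lam β γ hω hl hβ T hT μ hG hSI hRefl D hP hShift hAbs hCont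
    h hh S hS Sb hSb fh hfh χk hχk
    (stub_noFrozenSiteEnergy_of_cesaroRelaxation ω₂ lam β γ hω hl hβ T hT μ hG hSI hRefl D hP hShift hAbs hCont
      h hh S hS Sb hSb hC)

/-- **Rider (pointwise SR ∘ E): pointwise relaxation (mixing) of the site energy ⟹ infrared non-freezing.**
Same conclusion as `infraredNonFreezing_of_cesaroRelaxation` under the pointwise hypothesis `S(0,t) → 0`
(`noFrozenSiteEnergy_of_siteEnergyRelaxation` fed into the landed `stub_infraredNonFreezingOfNoFrozenSiteEnergy`).
[folklore] -/
theorem infraredNonFreezing_of_siteEnergyRelaxation :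
    ∀ ω₂ lam β γ : ℝ, 0 < ω₂ → 0 < lam → 0 < β → ∀ T : ℝ, 0 < T → ∀ μ : MeasureTheory.Measure Literature.MathematicalPhysics.KineticTheory.HeatConduction.ChainConfig, (Literature.MathematicalPhysics.KineticTheory.HeatConduction.pinnedChain ω₂ lam β γ).IsChainGibbsMeasure T μ → Literature.MathematicalPhysics.KineticTheory.HeatConduction.IsShiftInvariant μ → μ.map (fun σ : Literature.MathematicalPhysics.KineticTheory.HeatConduction.ChainConfig => fun x : ℤ => ((σ x).1, -(σ x).2)) = μ → ∀ D : Literature.MathematicalPhysics.KineticTheory.HeatConduction.InfiniteChainDynamics (Literature.MathematicalPhysics.KineticTheory.HeatConduction.pinnedChain ω₂ lam β γ), D.PreservesMeasure μ → (∀ t : ℝ, ∀ᵐ σ ∂μ, D.flow t (Literature.MathematicalPhysics.KineticTheory.HeatConduction.shift σ) = Literature.MathematicalPhysics.KineticTheory.HeatConduction.shift (D.flow t σ)) → (∀ t : ℝ, D.HasAbsConvergentCorrelation μ t) → Continuous (fun t : ℝ => D.currentCorrelation μ t) → ∀ h : Literature.MathematicalPhysics.KineticTheory.HeatConduction.ChainConfig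 → ℤ → ℝ, h = (fun (σ : Literature.MathematicalPhysics.KineticTheory.HeatConduction.ChainConfig) (x : ℤ) => (σ x).2 ^ 2 / 2 + (Literature.MathematicalPhysics.KineticTheory.HeatConduction.pinnedChain ω₂ lam β γ).U (σ x).1 + ((Literature.MathematicalPhysics.KineticTheory.HeatConduction.pinnedChain ω₂ lam β γ).V ((σ (x + 1)).1 - (σ x).1) + (Literature.MathematicalPhysics.KineticTheory.HeatConduction.pinnedChain ω₂ lam β γ).V ((σ x).1 - (σ (x - 1)).1)) / 2) → ∀ S : ℤ → ℝ → ℝ, S = (fun (x : ℤ) (t : ℝ) => ∫ σ, (h σ 0 - ∫ σ', h σ' 0 ∂μ) * (h (D.flow t σ) x - ∫ σ', h σ' 0 ∂μ) ∂μ) → ∀ Sb : ℝ → ℤ → ℝ, Sb = (fun (ν : ℝ) (x : ℤ) => ν * ∫ t in Set.Ioi (0:ℝ), Real.exp (-(ν * t)) * S x t) → ∀ fh : ℝ → ℝ → ℝ, fh = (fun (ν k : ℝ) => ∑' x : ℤ, Real.cos (k * (x : ℝ)) * Sb ν x) → ∀ χk : ℝ → ℝ, χk = (fun k : ℝ =>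 ∑' x : ℤ, Real.cos (k * (x : ℝ)) * S x 0) → Filter.Tendsto (fun t : ℝ => S 0 t) Filter.atTop (nhds 0) → ∀ M ν₁ : ℝ, 0 < ν₁ → ∃ k : ℝ, Real.cos k ≠ 1 ∧ ∃ ν : ℝ, 0 < ν ∧ ν < ν₁ ∧ M * (2 - 2 * Real.cos k) ≤ χk k - fh ν k := by
  intro ω₂ lam β γ hω hl hβ T hT μ hG hSI hRefl D hP hShift hAbs hCont h hh S hS Sb hSb fh hfh χk hχk hrelax
  exact stub_infraredNonFreezingOfNoFrozenSiteEnergy ω₂ lam β γ hω hl hβ T hT μ hG hSI hRefl D hP hShift hAbs hCont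
    h hh S hS Sb hSb fh hfh χk hχk
    (noFrozenSiteEnergy_of_siteEnergyRelaxation ω₂ lam β γ hω hl hβ T hT μ hG hSI hRefl D hP hShift hAbs hCont
      h hh S hS Sb hSb hrelax)

end Summit.AtomisticToContinuum.FouriersLaw.Theorems.UnboundedHeatVariance.Sketch

end
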